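import Summits.HodgeConjecture.HodgeConjecture.Theorems.F0P3cStCharTSWeylCartanRadial   -- ★ p851692 «ELL-TOR★» (this seat): `isClosed_cartan`, `mul_comm_cartan`, `centralizer_eq_cartan_of_isRegularElt`, `isRegularElt_conj_val_iff`
import Summits.HodgeConjecture.HodgeConjecture.Theorems.F0P3cStCharTSWeylHypWIF         -- ★ (LH2-p02 (g3)) «WIF-HYP COROLLARY»: generic §1 `orbitalIntegral_eq_integral_conjFamily_of_centralizer_eq`; brings ★ `OrbitalMeasureCanonicalAtPoint` ∕ `…ExistsCM`
import HarnessLib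

/-!
# F0 · P3c · line LH6 «StCharTS» — «ELL-TOR★» (E3) «ORBINT-ON-CARTAN»: the CANONICAL orbital integral at a regular element of ANY Cartan subgroup `T = Z(γ₀)` of
# `U(Φ₃)(L⁺_v)` is the fibre integral of the conjugation family over `G ⧸ T` against `ν ∕ t_T`, `t_T` THE Haar measure of `T` with mass one on its compact core
# (Rogawski 1990 §4.3 (4.3.1) p. 43, §12.5 p. 182; Deitmar–Echterhoff Thm. 1.5.3)

Cell `pub/hodgecm-mathlib`, crux H413 = `stmt-HodgeConjecture-24833` (lane `--supports`, helper); seat F0P3a-p05 (g22); road «ELL-TOR★» (NAMING 2026-09-02T14:19:42Z, «=» LH6-p03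
(g5) 14:22:45Z).  The transposition of ★ `F0P3cStCharTSWeylHypWIF` §2 (LH2-p02 (g3)) from the split torus `M` to every Cartan `T = Z(γ₀)`.  THEOREMS ONLY; sorry-free; no
definition ∕ instance ∕ notation ∕ named fact; ★-only imports; axioms TRIO.

WHY.  ★ p851692 ∕ (E1b) ∕ (E2b) state the Weyl integration formula over a system of Cartan representatives with the orbital integral written as the FIBRE INTEGRAL
`∫_{G ⧸ T} φ(Φ(q, t)) d(ν ∕ tm)`; the (S-𝔇) organ and print [Rogawski1990 §12.5 p. 182 «`Φ(γ, f)`», §4.3 (4.3.1)] speak of the CANONICAL orbital integral `classOrbitalIntegral mQv`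
(★ `OrbitalMeasureFamily.IsCanonical`: quotient of `ν` by THE Haar measure of `Z(γ)` with mass one on the compact core).  ★ `F0P3cStCharTSWeylHypWIF` §2 identified the two at the
split torus `M`; this file does it at every Cartan `T = Z(γ₀)`, so that (E2b)'s «WIF BY SHAPE» reads in the organ's currency term for term (`tm := t_T`):
* §1 **`exists_haar_cartan_compactCore_eq_one`** — `T = Z(γ₀)` (`γ₀` regular) carries a Haar measure, inversion invariant, with mass `1` on `compactCore T` (★
  `forall_isRegularElt_exists_isHaarMeasure_compactCore_centralizer_local_eq_one` at `γ₀`, read on `T`); for a COMPACT Cartan `compactCore T = T`, so this is the Haar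
  probability measure — print's «`meas(T) = 1`» normalisation of §12.5–§12.6.
* §2 **`classOrbitalIntegral_mk_eq_integral_conjFamily_cartan`** — for `mQv` canonical for the regular classes (the organ's `hcanQ`), `t_T` as in §1, `t ∈ T^{reg}` and `φ`
  measurable: **`classOrbitalIntegral mQv φ ⟦t⟧ = ∫_{G ⧸ T} φ(Φ(q, t)) d(ν ∕ t_T)(q)`** (★ `IsCanonical.classOrbitalIntegral_mk_eq_orbitalIntegral'` with the canonical torus measure of
  `Z(t)`, which read on `T = Z(t)` (★ p851692 `centralizer_eq_cartan_of_isRegularElt`) IS `t_T` by Haar uniqueness under the compact-core normalisation (★ `eq_of_apply_compactCore_eq_one`,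
  ★ `image_compactCore`), then ★ WIF §1 `orbitalIntegral_eq_integral_conjFamily_of_centralizer_eq`).
CARRIER: `Gqs L v` with `T : Subgroup (Gqs L v)`, `hT : T = Subgroup.centralizer {γ₀}`, as in ★ p851692; the `«local»`-spelled ★ existence lemma is fed the caller's σ-algebra by
`letI` (the idiom of ★ WIF §2).
HONEST LABEL: count-neutral dictionary brick for the WIF antecedent of RUNG0's named block; closes no organ.  HC_CM is proved only modulo the 7 printed citations (2 remaining:
hLiu418 = `stmt-HodgeConjecture-24832`, h413 = `stmt-HodgeConjecture-24833`) until rung 0 closes.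

## References
* [Rogawski1990] J. D. Rogawski, *Automorphic Representations of Unitary Groups in Three Variables*, Ann. of Math. Stud. 123 (1990), §4.3 (4.3.1) p. 43 (orbital integrals and
  their measures), §1.7 p. 6 (normalisations), §12.5 p. 182 (`Φ(γ, f)` in the Weyl integration formula).
* [DeitmarEchterhoff2014] A. Deitmar, S. Echterhoff, *Principles of Harmonic Analysis*, 2nd ed. (2014), Thm. 1.5.3 (invariant quotient measures).
* [HarishChandra1970] Harish-Chandra (notes by G. van Dijk), *Harmonic analysis on reductive p-adic groups*, LNM 162 (1970), Lemma 42.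
-/

set_option autoImplicit false
-- the mandated namespace has the single-problem summit's repeated segment (`HodgeConjecture.HodgeConjecture`)
set_option linter.dupNamespace false

noncomputable section

open MeasureTheory Measure Set Filter Topology Function NumberField IsDedekindDomain Matrix Polynomial
open Literature.MeasureTheory.Group
open Literature.NumberTheory.Automorphic Literature.NumberTheory.Automorphic.UnitaryGroup Literature.NumberTheory.Rogawski1990
open Summit.HodgeConjecture.HodgeConjecture.Cruxes.H413.F0P3cStCharTSWeylCartanRadial
open Summit.HodgeConjecture.HodgeConjecture.Cruxes.H413.F0P3cStCharTSWeylHypWIF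
open scoped ENNReal NNReal MatrixGroups Pointwise

namespace Summit.HodgeConjecture.HodgeConjecture.Cruxes.H413.F0P3cStCharTSWeylCartanOrbInt

section CM

variable {L : Type} [Field L] [NumberField L] [IsCMField L] {v : HeightOneSpectrum (𝓞 ↥(maximalRealSubfield L))}
  {T : Subgroup (Gqs L v)} {γ₀ : Gqs L v} (hγ₀ : IsRegularElt (γ₀.val : GL (Fin 3) (LocalRing L v)))
  (hT : T = Subgroup.centralizer ({γ₀} : Set (Gqs L v)))

/-! ## §1 The normalised Haar measure of a Cartan subgroup -/

include hγ₀ hT in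
/-- **Every Cartan subgroup `T = Z(γ₀)` of `U(Φ₃)(L⁺_v)` (`γ₀` regular, any finite `v`) carries a Haar measure, inversion invariant, with mass `1` on its compact core** (★
`forall_isRegularElt_exists_isHaarMeasure_compactCore_centralizer_local_eq_one` at `γ₀`).  For `T` compact this is the Haar probability measure. [cite: Rogawski1990, §4.3 (4.3.1) p. 43; §1.7 p. 6] -/
theorem exists_haar_cartan_compactCore_eq_one [MeasurableSpace (Gqs L v)] [BorelSpace (Gqs L v)] :
    ∃ tT : Measure ↥T, tT.IsHaarMeasure ∧ tT.IsInvInvariant ∧ tT (compactCore ↥T) = 1 := by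
  -- the `«local»` carrier IS `Gqs L v`: hand it the σ-algebra
  letI : MeasurableSpace ↥(«local» L (IsCMField.complexConj L) 3 (Matrix.of fun i j : Fin 3 => if i.val + j.val + 1 = 3 then (1 : L) else 0) v) := ‹MeasurableSpace (Gqs L v)›
  haveI : BorelSpace ↥(«local» L (IsCMField.complexConj L) 3 (Matrix.of fun i j : Fin 3 => if i.val + j.val + 1 = 3 then (1 : L) else 0) v) := ‹BorelSpace (Gqs L v)›
  have h : ∃ tZ : Measure ↥(Subgroup.centralizer ({γ₀} : Set (Gqs L v))),
      tZ.IsHaarMeasure ∧ tZ.IsInvInvariant ∧ tZ (compactCore ↥(Subgroup.centralizer ({γ₀} : Set (Gqs L v)))) = 1 :=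
    forall_isRegularElt_exists_isHaarMeasure_compactCore_centralizer_local_eq_one (IsCMField.complexConj L) 3
      (Matrix.of fun i j : Fin 3 => if i.val + j.val + 1 = 3 then (1 : L) else 0) (IsCMField.complexConj_ne_one L) (antidiagOne_map_transpose (IsCMField.complexConj L) 3)
      (isUnit_antidiagOne_det L 3) γ₀ hγ₀
  subst hT
  exact h

/-! ## §2 Canonical orbital integrals at regular elements of a Cartan subgroup are fibre integrals over `G ⧸ T` -/

set_option maxHeartbeats 800000 in
-- instance-term unification at the CM carrier (`quotientMeasure` ∕ canonical family), as ★ `F0P3cStCharTSWeylHypWIF` §2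
include hγ₀ in
/-- **CANONICAL ORBITAL INTEGRAL AT A REGULAR `t ∈ T = Z(γ₀)` = FIBRE INTEGRAL OF THE CONJUGATION FAMILY** (every finite `v`): for `mQv` canonical for the regular classes (★
`IsCanonical`, the (S-𝔇) organ's `hcanQ`), `t_T` THE Haar measure of `T` with `t_T(compactCore T) = 1`, `t ∈ T^{reg}` and `φ` measurable:
**`classOrbitalIntegral mQv φ ⟦t⟧ = ∫_{G ⧸ T} φ(Φ(q, t)) d(ν ∕ t_T)(q)`** — ★ `IsCanonical.classOrbitalIntegral_mk_eq_orbitalIntegral'` with the canonical torus measure of `Z(t)`,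
which read on `T = Z(t)` (★ p851692 `centralizer_eq_cartan_of_isRegularElt`) IS `t_T` (★ `eq_of_apply_compactCore_eq_one`, ★ `image_compactCore`), then ★ WIF §1
`orbitalIntegral_eq_integral_conjFamily_of_centralizer_eq`.  The `M`-case is ★ `F0P3cStCharTSWeylHypWIF.classOrbitalIntegral_mk_eq_integral_conjFamily`.
[cite: Rogawski1990, §4.3 (4.3.1) p. 43; §12.5 p. 182] [cite: DeitmarEchterhoff2014, Thm. 1.5.3] -/
theorem classOrbitalIntegral_mk_eq_integral_conjFamily_cartan
    [MeasurableSpace (Gqs L v)] [BorelSpace (Gqs L v)] [LocallyCompactSpace (Gqs L v)] [SecondCountableTopology (Gqs L v)] [T2Space (Gqs L v)]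
    [∀ γ : Gqs L v, MeasurableSpace (Gqs L v ⧸ Subgroup.centralizer ({γ} : Set (Gqs L v)))]
    [∀ γ : Gqs L v, BorelSpace (Gqs L v ⧸ Subgroup.centralizer ({γ} : Set (Gqs L v)))]
    [MeasurableSpace (Gqs L v ⧸ T)] [BorelSpace (Gqs L v ⧸ T)]
    (ν : Measure (Gqs L v)) [ν.IsHaarMeasure] [ν.IsMulRightInvariant]
    {mQv : OrbitalMeasureFamily (Gqs L v)} (hcanQ : mQv.IsCanonical (fun γ => IsRegularElt (γ.val : GL (Fin 3) (LocalRing L v))) ν)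
    (tT : Measure ↥T) [tT.IsHaarMeasure] [tT.IsInvInvariant] (htT : tT (compactCore ↥T) = 1)
    (Φ : (Gqs L v ⧸ T) × ↥T → Gqs L v) (hΦ : ∀ (x : Gqs L v) (t : ↥T), Φ (QuotientGroup.mk x, t) = x * t * x⁻¹)
    (t : ↥T) (ht : IsRegularElt (((t : Gqs L v)).val : GL (Fin 3) (LocalRing L v))) (φ : Gqs L v → ℂ) (hφ : Measurable φ) :
    classOrbitalIntegral mQv φ (ConjClasses.mk (t : Gqs L v)) = ∫ q, φ (Φ (q, t)) ∂(quotientMeasure T tT (isClosed_cartan hT) ν) := by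
  have hTcl := isClosed_cartan hT
  have hZeq : Subgroup.centralizer ({(t : Gqs L v)} : Set (Gqs L v)) = T := centralizer_eq_cartan_of_isRegularElt hγ₀ hT t ht
  have hZ : ∀ g : Gqs L v, (MulEquiv.refl (Gqs L v)) g ∈ T ↔ g ∈ Subgroup.centralizer ({(t : Gqs L v)} : Set (Gqs L v)) := fun g => by
    rw [MulEquiv.refl_apply, hZeq]
  letI : MeasurableSpace ↥(«local» L (IsCMField.complexConj L) 3 (Matrix.of fun i j : Fin 3 => if i.val + j.val + 1 = 3 then (1 : L) else 0) v) := ‹MeasurableSpace (Gqs L v)›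
  haveI : BorelSpace ↥(«local» L (IsCMField.complexConj L) 3 (Matrix.of fun i j : Fin 3 => if i.val + j.val + 1 = 3 then (1 : L) else 0) v) := ‹BorelSpace (Gqs L v)›
  have hexZ : ∃ tZ : Measure ↥(Subgroup.centralizer ({(t : Gqs L v)} : Set (Gqs L v))),
      tZ.IsHaarMeasure ∧ tZ.IsInvInvariant ∧ tZ (compactCore ↥(Subgroup.centralizer ({(t : Gqs L v)} : Set (Gqs L v)))) = 1 :=
    forall_isRegularElt_exists_isHaarMeasure_compactCore_centralizer_local_eq_one (IsCMField.complexConj L) 3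
      (Matrix.of fun i j : Fin 3 => if i.val + j.val + 1 = 3 then (1 : L) else 0) (IsCMField.complexConj_ne_one L) (antidiagOne_map_transpose (IsCMField.complexConj L) 3)
      (isUnit_antidiagOne_det L 3) (t : Gqs L v) ht
  obtain ⟨tZ, hZhaar, hZinv, hZone⟩ := hexZ
  haveI := hZhaar
  haveI := hZinv
  -- `tT` is `tZ` read on `T`: both are Haar measures on `T` with mass one on the compact core
  set e := subgroupCongrHomeomorph (MulEquiv.refl (Gqs L v)) (Subgroup.centralizer ({(t : Gqs L v)} : Set (Gqs L v))) T hZ continuous_id continuous_id with he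
  obtain ⟨e', hee'⟩ : ∃ e' : ↥(Subgroup.centralizer ({(t : Gqs L v)} : Set (Gqs L v))) ≃ₜ* ↥T,
      (⇑e : ↥(Subgroup.centralizer ({(t : Gqs L v)} : Set (Gqs L v))) → ↥T) = ⇑e' :=
    ⟨{ MulEquiv.subgroupCongr hZeq with continuous_toFun := e.continuous, continuous_invFun := e.symm.continuous }, rfl⟩
  haveI : LocallyCompactSpace ↥T := hTcl.isClosedEmbedding_subtypeVal.locallyCompactSpace
  haveI : SecondCountableTopology ↥T := TopologicalSpace.Subtype.secondCountableTopology _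
  haveI : (Measure.map e tZ).IsHaarMeasure := by rw [hee']; exact ContinuousMulEquiv.isHaarMeasure_map tZ e'
  have htZ : tT = Measure.map e tZ := by
    refine eq_of_apply_compactCore_eq_one tT _ htT ?_
    have hme : MeasurableEmbedding (⇑e') := e'.toHomeomorph.measurableEmbedding
    rw [hee', ← image_compactCore e', hme.map_apply]
    change tZ (e' ⁻¹' (e' '' compactCore ↥(Subgroup.centralizer ({(t : Gqs L v)} : Set (Gqs L v))))) = 1
    rwa [e'.injective.preimage_image]
  have hconj : ∀ g x : Gqs L v, IsRegularElt (g.val : GL (Fin 3) (LocalRing L v)) → IsRegularElt ((x * g * x⁻¹ : Gqs L v).val : GL (Fin 3) (LocalRing L v)) :=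
    fun g x hg => (isRegularElt_conj_val_iff L v x g).2 hg
  have hco := hcanQ.classOrbitalIntegral_mk_eq_orbitalIntegral' hconj ht tZ hZone φ
  rw [hco]
  exact orbitalIntegral_eq_integral_conjFamily_of_centralizer_eq T hTcl ν tT Φ hΦ t hZ tZ htZ φ hφ

end CM

end Summit.HodgeConjecture.HodgeConjecture.Cruxes.H413.F0P3cStCharTSWeylCartanOrbInt
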